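import Literature.AlgebraicGeometry.Hyperkaehler.K3HilbertMukaiLatticeMonodromyInvariant
import HarnessLib

/-!
# The divisibility `t = div(h)` is the index of `⟨ι(h)⟩ ⊕ ⟨v⟩` in `T(X, h)`
# (Apostolov, *Moduli spaces of polarized irreducible symplectic manifolds are not necessarily connected*,
# Ann. Inst. Fourier 64 (2014), §2 Prop. 2.2)

Layer `Literature/AlgebraicGeometry/Hyperkaehler`. Written for lane `lit-hodgefound` (Track 2 foundations; prover seat
`lit-hodgefound-p18`, gen 47, row g47-#12). Sequel of `K3HilbertMukaiLatticeMonodromyInvariant.lean` (g47-#11: the pair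
`(T(h), ι h)`, `T(h) = (ℤ·ι h ⊔ ι(L)^⊥)^⊥⊥` the saturation of `⟨ι h⟩ ⊕ ι(L)^⊥`, is a faithful invariant). THEOREMS ONLY —
no definition, no named fact, no instance, no notation.

## Source, verbatim (A. Apostolov, Ann. Inst. Fourier 64 (2014) §2; held text `paper:arxiv-1109.0175` p. 9)

"Let `X` be of `K3^{[n]}`-type and let `h_d ∈ H²(X, ℤ)` be of degree `2d` and choose `ι` in the orbit `[ι_X]`, so that
`Im(ι)^⊥` is generated by the vector `v := (1, 0, 1−n) ∈ Λ̃`. Set `t := div(h_d)` to be the divisibility of `h_d`, i.e.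
the positive generator of the ideal `(h_d, Λ_n)` in `ℤ`. The next proposition relates `t` to the index of
`⟨ι(h_d)⟩ ⊕ ⟨v⟩` in the saturation `T(X, h)` with respect to `ι_X`. **Proposition 2.2.** The integer `t` is equal to the
index of `⟨ι(h_d)⟩ ⊕ ⟨v⟩` in `T(X, h)`." From the printed proof: "Now the class `(ι(h_d) − cv)/t` […] is integral because
`t | 2n−2`. Hence it belongs to the saturation". (And §2 before Prop. 2.1: "`Σ_n^{d,l} ⊂ Σ_n` […] the set of isometry
classes of pairs `(T, h)` such that `T` has discriminant `4d(n−1)/l²`, `h` has length `2d`".)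

## The formalisation (coordinate-free form of the printed argument)

Apostolov computes in Mukai coordinates `Λ̃ = H²(S) ⊕ U` for the particular `ι` with `v = (1, 0, 1−n)`; by the
transitivity of `O(Λ̃)` on primitive embeddings (rows g47-#9/#10) nothing depends on that choice, and we argue directly
for ANY `ι` with `ι(L) = v^⊥`, `ι(L)^⊥ = ℤv` in a symmetric unimodular `Λ`: the functional `y ↦ (ι h, y)/t` on the
primitive sublattice `ι(L)` is integral (`t | (h, L)`), hence represented by some `z ∈ Λ` up to `ι(L)^⊥ = ℤv`
(`exists_dualFamily_of_saturated`), i.e. **`t z = ι h + q v`** — this `z` is the printed "`(ι(h_d) − cv)/t` […] belongs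
to the saturation". Pairing with `ι y₀`, `(h, y₀) = t`, gives the homomorphism `μ = (·, ι y₀) : T(h) → ℤ` with
`μ(z) = 1`, kernel `ℤv` and `μ(⟨ι h⟩ ⊕ ⟨v⟩) = tℤ`, whence `T(h) = ℤz ⊕ ℤv`, `[T(h) : ⟨ι h⟩ ⊕ ⟨v⟩] = |t|` and
`t²·disc T(h) = (h, h)(v, v)`. The divisibility enters only as "`t | (h, y)` for all `y` and `(h, y₀) = t` for some
`y₀`" (for `t = div(h)` both hold); primitivity of `h` is not needed.

## Contents (all proved)

§1 (general): `exists_smul_eq_add_smul_of_forall_dvd` (the vector `z`),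
`mem_span_singleton_of_mem_orthogonal_orthogonal_of_apply_embedding_eq_zero` (`ker μ = ℤv` on `T(h)`),
**`relIndex_span_sup_orthogonal_eq` (Prop. 2.2: the relative index of `ℤ·ι h ⊔ ι(L)^⊥` in `T(h)` is `|t|`)**,
`exists_orthogonal_orthogonal_eq_span_sup` (`T(h) = ℤz ⊕ ℤv`, `t z = ι h + q v`, `t²((z,z)(v,v) − (z,v)²) = (h,h)(v,v)`).
§2 `Λ_n ↪ Λ̃ = E₈(−1)^{⊕2} ⊕ U^{⊕4}`, `n ≥ 2`, any primitive `ι`: `k3HilbertLattice_relIndex_pairLattice` — Prop. 2.2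
and `disc T(X, h) · t² = (h, h)(2n − 2)` (i.e. `disc T = 4d(n−1)/t²` for `(h, h) = 2d`, the condition defining
`Σ_n^{d,t}`).

## References

* [Apostolov2014NotConnected] A. Apostolov, Moduli spaces of polarized irreducible symplectic manifolds are not
  necessarily connected, Ann. Inst. Fourier 64 (2014) 189–202 (arXiv:1109.0175): §2 Prop. 2.2 and its proof; §2
  (definition of `Σ_n^{d,l}`).
* [Nikulin1980] V. V. Nikulin, Integral symmetric bilinear forms and some of their applications (1980): §1.2–§1.3
  (primitive sublattices of unimodular lattices).
-/

noncomputable section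

open Module Function
open LinearMap (BilinForm)
open Literature.Topology.FourManifolds Literature.AlgebraicGeometry.Surfaces

namespace LinearMap.BilinForm

/-! ### §1 `[T(h) : ⟨ι h⟩ ⊕ ⟨v⟩] = t` for `(h, L) = tℤ` -/

section Index

variable {X : Type*} [AddCommGroup X] [Module.Finite ℤ X] [Module.Free ℤ X] (Λ : BilinForm ℤ X)
variable {M : Type*} [AddCommGroup M] {L : BilinForm ℤ M}



omit [Module.Finite ℤ X] [Module.Free ℤ X] in
/-- The elements of `ℤa ⊔ N` are the `p a + n`. [folklore] -/
private theorem mem_span_singleton_sup_iff {a x : X} {N : Submodule ℤ X} :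
    x ∈ (ℤ ∙ a) ⊔ N ↔ ∃ (p : ℤ) (n : X), n ∈ N ∧ x = p • a + n := by
  rw [Submodule.mem_sup]
  constructor
  · rintro ⟨y, hy, n, hn, rfl⟩
    obtain ⟨p, rfl⟩ := Submodule.mem_span_singleton.1 hy
    exact ⟨p, n, hn, rfl⟩
  · rintro ⟨p, n, hn, rfl⟩
    exact ⟨p • a, Submodule.mem_span_singleton.2 ⟨p, rfl⟩, n, hn, rfl⟩

/-- **The vector `(ι(h) − c v)/t`** of Apostolov's proof, coordinate-free: if `(h, L) ⊆ tℤ` and `(h, y₀) = t`, there are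
`z ∈ Λ` and `q ∈ ℤ` with `t z = ι h + q v` and `(z, ι y₀) = 1` (the functional `(ι h, ·)/t` on the primitive `ι(L)` is
represented in the unimodular `Λ`, up to `ι(L)^⊥ = ℤv`). [cite: Apostolov2014NotConnected, §2 Prop. 2.2 (proof: "the class
`(ι(h_d) − cv)/t` … belongs to the saturation")] -/
theorem exists_smul_eq_add_smul_of_forall_dvd [Λ.IsPerfPair] (hΛ : Λ.IsSymm) {ι : M →ₗ[ℤ] X}
    (hιC : ∀ x y, Λ (ι x) (ι y) = L x y) {v : X}
    (hrange : LinearMap.range ι = Λ.orthogonal (ℤ ∙ v)) (hSv : Λ.orthogonal (LinearMap.range ι) = ℤ ∙ v)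
    {h : M} {t : ℤ} (ht : t ≠ 0) (hdiv : ∀ y, t ∣ L h y) {y₀ : M} (hy₀ : L h y₀ = t) :
    ∃ (z : X) (q : ℤ), t • z = ι h + q • v ∧ Λ z (ι y₀) = 1 := by
  have hsat : ∀ (c : ℤ) (w : X), c ≠ 0 → c • w ∈ LinearMap.range ι → w ∈ LinearMap.range ι := by
    rw [hrange]; exact fun c w hc hw ↦ Λ.mem_orthogonal_of_smul_mem _ hc hw
  obtain ⟨m, b⟩ := Module.basisOfFiniteTypeTorsionFree' (R := ℤ) (M := LinearMap.range ι)
  obtain ⟨s, hs⟩ := exists_dualFamily_of_saturated Λ hΛ hsat b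
  have hdvd : ∀ j, t ∣ Λ (ι h) (b j) := fun j ↦ by
    obtain ⟨y, hy⟩ := LinearMap.mem_range.1 (b j).2
    rw [← hy, hιC]
    exact hdiv y
  let z : X := ∑ j, (Λ (ι h) (b j) / t) • s j
  have hz : ∀ i, Λ (b i) z = Λ (ι h) (b i) / t := fun i ↦ by
    simp only [z, map_sum, map_smul, smul_eq_mul, hs, mul_ite, mul_one, mul_zero, Finset.sum_ite_eq,
      Finset.mem_univ, if_true]
  have horth : ∀ n ∈ LinearMap.range ι, Λ n (t • z - ι h) = 0 := by
    have hlin : (Λ.flip (t • z - ι h)) ∘ₗ (LinearMap.range ι).subtype = 0 := by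
      refine b.ext fun i ↦ ?_
      rw [LinearMap.comp_apply, Submodule.subtype_apply, flip_apply, LinearMap.zero_apply, map_sub,
        map_smul, smul_eq_mul, hz, Int.mul_ediv_cancel' (hdvd i), hΛ.eq, sub_self]
    intro n hn
    have := LinearMap.congr_fun hlin ⟨n, hn⟩
    rwa [LinearMap.comp_apply, Submodule.subtype_apply, flip_apply, LinearMap.zero_apply] at this
  have hmem : t • z - ι h ∈ ℤ ∙ v := by
    rw [← hSv, mem_orthogonal_iff]
    exact horth
  obtain ⟨q, hq⟩ := Submodule.mem_span_singleton.1 hmem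
  refine ⟨z, q, by rw [hq]; abel, ?_⟩
  have h1 : Λ (ι y₀) (t • z - ι h) = 0 := horth _ (LinearMap.mem_range_self ι y₀)
  rw [map_sub, map_smul, smul_eq_mul, hιC, ← hΛ.eq z (ι y₀)] at h1
  have h2 : L y₀ h = t := by rw [← hιC, hΛ.eq, hιC, hy₀]
  rw [h2] at h1
  have h3 : t * (Λ z (ι y₀) - 1) = 0 := by linear_combination h1
  exact sub_eq_zero.1 ((mul_eq_zero.1 h3).resolve_left ht)

/-- **`ker (·, ι y₀) ∩ T(h) = ℤv`**: a vector of `T(h) = (ℤ·ι h ⊔ ℤv)^⊥⊥` orthogonal to `ι y₀`, where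
`(h, y₀) = t ≠ 0`, lies in `ℤv` (`k w = p·ι h + c v` with `p t = k (w, ι y₀) = 0`; `v` primitive).
[cite: Apostolov2014NotConnected, §2 Prop. 2.2 (proof)] -/
theorem mem_span_singleton_of_mem_orthogonal_orthogonal_of_apply_embedding_eq_zero [Λ.IsPerfPair] (hΛ : Λ.IsSymm)
    {ι : M →ₗ[ℤ] X} (hιC : ∀ x y, Λ (ι x) (ι y) = L x y) {v : X} (hv : Λ v v ≠ 0)
    (hrange : LinearMap.range ι = Λ.orthogonal (ℤ ∙ v)) (hSv : Λ.orthogonal (LinearMap.range ι) = ℤ ∙ v)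
    (hprim : ∀ (k : ℤ) (w : X), k ≠ 0 → k • w ∈ ℤ ∙ v → w ∈ ℤ ∙ v) {h : M} (hh : L h h ≠ 0) {t : ℤ} (ht : t ≠ 0)
    {y₀ : M} (hy₀ : L h y₀ = t) {w : X}
    (hw : w ∈ Λ.orthogonal (Λ.orthogonal ((ℤ ∙ ι h) ⊔ Λ.orthogonal (LinearMap.range ι)))) (hw0 : Λ w (ι y₀) = 0) :
    w ∈ ℤ ∙ v := by
  have hιh : Λ (ι h) (ι h) ≠ 0 := by rwa [hιC]
  have hιv : Λ (ι h) v = 0 := by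
    have hm : ι h ∈ Λ.orthogonal (ℤ ∙ v) := hrange ▸ LinearMap.mem_range_self ι h
    rw [mem_orthogonal_iff] at hm
    rw [hΛ.eq]
    exact hm v (Submodule.mem_span_singleton_self v)
  have hvy : Λ v (ι y₀) = 0 := by
    have hm : ι y₀ ∈ Λ.orthogonal (ℤ ∙ v) := hrange ▸ LinearMap.mem_range_self ι y₀
    rw [mem_orthogonal_iff] at hm
    exact hm v (Submodule.mem_span_singleton_self v)
  rw [hSv] at hw
  -- rank: `rk (ℤ ι h ⊔ ℤ v)^⊥⊥ = rk (ℤ ι h ⊔ ℤ v)`, so `k w ∈ ℤ ι h ⊔ ℤ v`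
  have hnd : (Λ.restrict ((ℤ ∙ ι h) ⊔ (ℤ ∙ v))).Nondegenerate := by
    refine (LinearMap.IsRefl.nondegenerate_iff_separatingLeft (hΛ.restrict _).isRefl).2 fun x hx ↦ ?_
    obtain ⟨p, n, hn, hpq⟩ := (mem_span_singleton_sup_iff (x := (x : X))).1 x.2
    obtain ⟨q, rfl⟩ := Submodule.mem_span_singleton.1 hn
    have h1 : Λ x (ι h) = 0 := hx ⟨ι h, Submodule.mem_sup_left (Submodule.mem_span_singleton_self _)⟩
    have h2 : Λ x v = 0 := hx ⟨v, Submodule.mem_sup_right (Submodule.mem_span_singleton_self v)⟩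
    rw [hpq] at h1 h2
    simp only [map_add, map_smul, LinearMap.add_apply, LinearMap.smul_apply, smul_eq_mul, hιv, hΛ.eq v (ι h),
      mul_zero, add_zero, zero_add, mul_eq_zero] at h1 h2
    apply Subtype.ext
    rw [hpq, h1.resolve_right hιh, h2.resolve_right hv, zero_smul, zero_smul, add_zero]
    rfl
  obtain ⟨k, hk, hkw⟩ := Λ.exists_smul_mem_of_mem_orthogonal_orthogonal hΛ _ hnd hw
  obtain ⟨p, n, hn, hpq⟩ := (mem_span_singleton_sup_iff (x := k • w)).1 hkw
  obtain ⟨q, rfl⟩ := Submodule.mem_span_singleton.1 hn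
  have h1 := congrArg (fun u ↦ Λ u (ι y₀)) hpq
  simp only [map_add, map_smul, LinearMap.add_apply, LinearMap.smul_apply, smul_eq_mul, hw0, mul_zero, hιC, hy₀,
    hvy, add_zero] at h1
  have hp : p = 0 := (mul_eq_zero.1 h1.symm).resolve_right ht
  rw [hp, zero_smul, zero_add] at hpq
  exact hprim k w hk (hpq ▸ Submodule.mem_span_singleton.2 ⟨q, rfl⟩)

/-- **Proposition 2.2 (Apostolov): "The integer `t` is equal to the index of `⟨ι(h_d)⟩ ⊕ ⟨v⟩` in `T(X, h)`"** —
general lattice form: `Λ` symmetric unimodular, `ι : L ↪ Λ` isometric with `ι(L) = v^⊥`, `ι(L)^⊥ = ℤv`, `v` primitive,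
`(v, v) ≠ 0`, `(h, h) ≠ 0`, and `t ≠ 0` with `t | (h, y)` for all `y ∈ L`, `(h, y₀) = t` (i.e. `(h, L) = tℤ`,
`|t| = div(h)`): the relative index of `ℤ·ι h ⊔ ι(L)^⊥ = ⟨ι h⟩ ⊕ ⟨v⟩` in `T(h) = (ℤ·ι h ⊔ ι(L)^⊥)^⊥⊥` is `|t|`
(`μ = (·, ι y₀) : T(h) ↠ ℤ` has kernel `ℤv ⊆ ⟨ι h⟩ ⊕ ⟨v⟩` and `μ(⟨ι h⟩ ⊕ ⟨v⟩) = tℤ`).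
[cite: Apostolov2014NotConnected, §2 Prop. 2.2] -/
theorem relIndex_span_sup_orthogonal_eq [Λ.IsPerfPair] (hΛ : Λ.IsSymm) {ι : M →ₗ[ℤ] X}
    (hιC : ∀ x y, Λ (ι x) (ι y) = L x y) {v : X} (hv : Λ v v ≠ 0)
    (hrange : LinearMap.range ι = Λ.orthogonal (ℤ ∙ v)) (hSv : Λ.orthogonal (LinearMap.range ι) = ℤ ∙ v)
    (hprim : ∀ (k : ℤ) (w : X), k ≠ 0 → k • w ∈ ℤ ∙ v → w ∈ ℤ ∙ v) {h : M} (hh : L h h ≠ 0) {t : ℤ} (ht : t ≠ 0)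
    (hdiv : ∀ y, t ∣ L h y) {y₀ : M} (hy₀ : L h y₀ = t) :
    ((ℤ ∙ ι h) ⊔ Λ.orthogonal (LinearMap.range ι)).toAddSubgroup.relIndex
        (Λ.orthogonal (Λ.orthogonal ((ℤ ∙ ι h) ⊔ Λ.orthogonal (LinearMap.range ι)))).toAddSubgroup =
      t.natAbs := by
  obtain ⟨z, q, hz, hz1⟩ := Λ.exists_smul_eq_add_smul_of_forall_dvd hΛ hιC hrange hSv ht hdiv hy₀
  have hvy : Λ v (ι y₀) = 0 := by
    have hm : ι y₀ ∈ Λ.orthogonal (ℤ ∙ v) := hrange ▸ LinearMap.mem_range_self ι y₀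
    rw [mem_orthogonal_iff] at hm
    exact hm v (Submodule.mem_span_singleton_self v)
  have hST : (ℤ ∙ ι h) ⊔ Λ.orthogonal (LinearMap.range ι) ≤
      Λ.orthogonal (Λ.orthogonal ((ℤ ∙ ι h) ⊔ Λ.orthogonal (LinearMap.range ι))) :=
    Λ.le_orthogonal_orthogonal hΛ.isRefl
  have htzS : t • z ∈ (ℤ ∙ ι h) ⊔ Λ.orthogonal (LinearMap.range ι) := by
    rw [hz, hSv]
    exact Submodule.add_mem _ (Submodule.mem_sup_left (Submodule.mem_span_singleton_self _))
      (Submodule.mem_sup_right (Submodule.mem_span_singleton.2 ⟨q, rfl⟩))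
  have hzT : z ∈ Λ.orthogonal (Λ.orthogonal ((ℤ ∙ ι h) ⊔ Λ.orthogonal (LinearMap.range ι))) :=
    Λ.mem_orthogonal_of_smul_mem _ ht (hST htzS)
  -- `μ w = (w, ι y₀)` on `T(h)`
  let μ : Λ.orthogonal (Λ.orthogonal ((ℤ ∙ ι h) ⊔ Λ.orthogonal (LinearMap.range ι))) →+ ℤ :=
    ((Λ.flip (ι y₀)) ∘ₗ (Submodule.subtype _)).toAddMonoidHom
  have hμ : ∀ w, μ w = Λ w (ι y₀) := fun w ↦ by
    change (Λ.flip (ι y₀)) w = _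
    rw [flip_apply]
  have hμS : ∀ w : Λ.orthogonal (Λ.orthogonal ((ℤ ∙ ι h) ⊔ Λ.orthogonal (LinearMap.range ι))),
      (w : X) ∈ (ℤ ∙ ι h) ⊔ Λ.orthogonal (LinearMap.range ι) ↔ t ∣ μ w := by
    rintro ⟨w, hwT⟩
    change w ∈ _ ↔ _
    constructor
    · intro hw
      rw [hSv] at hw
      obtain ⟨p, n, hn, hpq⟩ := (mem_span_singleton_sup_iff (x := w)).1 hw
      obtain ⟨c, rfl⟩ := Submodule.mem_span_singleton.1 hn
      rw [hμ]
      change t ∣ Λ w (ι y₀)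
      rw [hpq]
      simp only [map_add, map_smul, LinearMap.add_apply, LinearMap.smul_apply, smul_eq_mul, hιC, hy₀, hvy, mul_zero,
        add_zero]
      exact Dvd.intro_left p rfl
    · rintro ⟨k, hk⟩
      -- `w − k t z ∈ ker μ ⊆ ℤ v`
      have hw' : w - k • (t • z) ∈ ℤ ∙ v := by
        refine Λ.mem_span_singleton_of_mem_orthogonal_orthogonal_of_apply_embedding_eq_zero hΛ hιC hv hrange hSv hprim hh ht
          hy₀ (Submodule.sub_mem _ hwT (Submodule.smul_mem _ k (Submodule.smul_mem _ t hzT))) ?_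
        have hk' : Λ w (ι y₀) = t * k := by rw [← hk, hμ]
        rw [map_sub, LinearMap.sub_apply, hk', map_smul, map_smul, LinearMap.smul_apply, LinearMap.smul_apply,
          hz1, smul_eq_mul, smul_eq_mul, mul_one, mul_comm, sub_self]
      have : w = (w - k • (t • z)) + k • (t • z) := by abel
      rw [this]
      refine Submodule.add_mem _ ?_ (Submodule.smul_mem _ k htzS)
      rw [hSv]
      exact Submodule.mem_sup_right hw'
  have hμsurj : Function.Surjective μ := fun k ↦ ⟨k • ⟨z, hzT⟩, by
    rw [map_zsmul, hμ, smul_eq_mul]; change k * Λ z (ι y₀) = k; rw [hz1, mul_one]⟩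
  have hcomap : ((ℤ ∙ ι h) ⊔ Λ.orthogonal (LinearMap.range ι)).toAddSubgroup.addSubgroupOf
      (Λ.orthogonal (Λ.orthogonal ((ℤ ∙ ι h) ⊔ Λ.orthogonal (LinearMap.range ι)))).toAddSubgroup =
      (AddSubgroup.zmultiples t).comap μ := by
    ext w
    rw [AddSubgroup.mem_addSubgroupOf, AddSubgroup.mem_comap, Int.mem_zmultiples_iff]
    exact hμS w
  rw [AddSubgroup.relIndex, hcomap]
  exact (AddSubgroup.index_comap_of_surjective (AddSubgroup.zmultiples t) hμsurj).trans (Int.index_zmultiples t)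

/-- **A basis of `T(X, h)` and its discriminant**: with `z` as above (`t z = ι h + q v`), `T(h) = ℤz ⊕ ℤv` and
`t²·((z, z)(v, v) − (z, v)²) = (h, h)(v, v)` — so `disc T(X, h) = (h, h)(v, v)/t² = 4d(n−1)/t²` for `(h, h) = 2d`,
`(v, v) = 2n − 2`, the discriminant prescribed in `Σ_n^{d,t}`. [cite: Apostolov2014NotConnected, §2 Prop. 2.2 (proof:
basis `e₁, e₂` of `T(X, h_d)`, "`β` is equal to the positive square root of `4d(n−1)/((e₁,e₁)(e₂,e₂) − (e₁,e₂)²)`") and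
§2 (definition of `Σ_n^{d,l}`)] -/
theorem exists_orthogonal_orthogonal_eq_span_sup [Λ.IsPerfPair] (hΛ : Λ.IsSymm) {ι : M →ₗ[ℤ] X}
    (hιC : ∀ x y, Λ (ι x) (ι y) = L x y) {v : X} (hv : Λ v v ≠ 0)
    (hrange : LinearMap.range ι = Λ.orthogonal (ℤ ∙ v)) (hSv : Λ.orthogonal (LinearMap.range ι) = ℤ ∙ v)
    (hprim : ∀ (k : ℤ) (w : X), k ≠ 0 → k • w ∈ ℤ ∙ v → w ∈ ℤ ∙ v) {h : M} (hh : L h h ≠ 0) {t : ℤ} (ht : t ≠ 0)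
    (hdiv : ∀ y, t ∣ L h y) {y₀ : M} (hy₀ : L h y₀ = t) :
    ∃ (z : X) (q : ℤ), t • z = ι h + q • v ∧
      Λ.orthogonal (Λ.orthogonal ((ℤ ∙ ι h) ⊔ Λ.orthogonal (LinearMap.range ι))) = (ℤ ∙ z) ⊔ (ℤ ∙ v) ∧
      t ^ 2 * (Λ z z * Λ v v - Λ z v ^ 2) = L h h * Λ v v := by
  obtain ⟨z, q, hz, hz1⟩ := Λ.exists_smul_eq_add_smul_of_forall_dvd hΛ hιC hrange hSv ht hdiv hy₀
  have hιv : Λ (ι h) v = 0 := by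
    have hm : ι h ∈ Λ.orthogonal (ℤ ∙ v) := hrange ▸ LinearMap.mem_range_self ι h
    rw [mem_orthogonal_iff] at hm
    rw [hΛ.eq]
    exact hm v (Submodule.mem_span_singleton_self v)
  have hST : (ℤ ∙ ι h) ⊔ Λ.orthogonal (LinearMap.range ι) ≤
      Λ.orthogonal (Λ.orthogonal ((ℤ ∙ ι h) ⊔ Λ.orthogonal (LinearMap.range ι))) :=
    Λ.le_orthogonal_orthogonal hΛ.isRefl
  have htzS : t • z ∈ (ℤ ∙ ι h) ⊔ Λ.orthogonal (LinearMap.range ι) := by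
    rw [hz, hSv]
    exact Submodule.add_mem _ (Submodule.mem_sup_left (Submodule.mem_span_singleton_self _))
      (Submodule.mem_sup_right (Submodule.mem_span_singleton.2 ⟨q, rfl⟩))
  have hzT : z ∈ Λ.orthogonal (Λ.orthogonal ((ℤ ∙ ι h) ⊔ Λ.orthogonal (LinearMap.range ι))) :=
    Λ.mem_orthogonal_of_smul_mem _ ht (hST htzS)
  have hvT : v ∈ Λ.orthogonal (Λ.orthogonal ((ℤ ∙ ι h) ⊔ Λ.orthogonal (LinearMap.range ι))) := by
    refine hST (Submodule.mem_sup_right ?_)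
    rw [hSv]
    exact Submodule.mem_span_singleton_self v
  refine ⟨z, q, hz, le_antisymm (fun w hw ↦ ?_) ?_, ?_⟩
  · -- `w − (w, ι y₀) z ∈ ker = ℤ v`
    have hw' : w - Λ w (ι y₀) • z ∈ ℤ ∙ v := by
      refine Λ.mem_span_singleton_of_mem_orthogonal_orthogonal_of_apply_embedding_eq_zero hΛ hιC hv hrange hSv hprim hh ht hy₀
        (Submodule.sub_mem _ hw (Submodule.smul_mem _ _ hzT)) ?_
      rw [map_sub, LinearMap.sub_apply, map_smul, LinearMap.smul_apply, hz1, smul_eq_mul, mul_one, sub_self]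
    have : w = Λ w (ι y₀) • z + (w - Λ w (ι y₀) • z) := by abel
    rw [this]
    exact Submodule.add_mem _ (Submodule.mem_sup_left (Submodule.mem_span_singleton.2 ⟨_, rfl⟩))
      (Submodule.mem_sup_right hw')
  · exact sup_le (Submodule.span_le.2 (Set.singleton_subset_iff.2 hzT))
      (Submodule.span_le.2 (Set.singleton_subset_iff.2 hvT))
  · -- Gram identity: `t z = ι h + q v`, `ι h ⊥ v`
    have h1 : t * t * Λ z z = L h h + q * q * Λ v v := by
      have := congrArg (fun u ↦ Λ u u) hz
      simp only [map_add, map_smul, LinearMap.add_apply, LinearMap.smul_apply, smul_eq_mul, hιC, hιv, hΛ.eq v (ι h),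
        mul_zero, add_zero, zero_add] at this
      linear_combination this
    have h2 : t * Λ z v = q * Λ v v := by
      have := congrArg (fun u ↦ Λ u v) hz
      simp only [map_add, map_smul, LinearMap.add_apply, LinearMap.smul_apply, smul_eq_mul, hιv, zero_add] at this
      linear_combination this
    linear_combination Λ v v * h1 - (t * Λ z v + q * Λ v v) * h2

end Index

end LinearMap.BilinForm

namespace Literature.AlgebraicGeometry.Hyperkaehler

open Literature.Topology.FourManifolds Literature.AlgebraicGeometry.Surfaces LinearMap.BilinForm

/-! ### §2 `Λ_n ↪ Λ̃` -/

/-- **Proposition 2.2 for `Λ_n = Λ(K3^{[n]}) ↪ Λ̃ = E₈(−1)^{⊕2} ⊕ U^{⊕4}`** (`n ≥ 2`, any primitive isometric `ι`,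
`h ∈ Λ_n` with `(h, h) ≠ 0`, `(h, Λ_n) = tℤ` in the form `t | (h, y)` for all `y`, `(h, y₀) = t`): the index of
`⟨ι h⟩ ⊕ ⟨v⟩` in `T(X, h)` is `|t|`, where `ι(Λ_n)^⊥ = ℤv`, `(v, v) = 2n − 2`; moreover `T(X, h) = ℤz ⊕ ℤv` with
`t z = ι h + q v` and `t²·disc T(X, h) = (h, h)·(2n − 2)` ("`T` has discriminant `4d(n−1)/l²`").
[cite: Apostolov2014NotConnected, §2 Prop. 2.2 and definition of `Σ_n^{d,l}`] -/
theorem k3HilbertLattice_relIndex_pairLattice {n : ℕ} (hn : 2 ≤ n)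
    {ι : (K3HilbertIndex → ℤ) →ₗ[ℤ] (Fin 2 → Fin 8 → ℤ) × ((Fin 4 → ℤ) × (Fin 4 → ℤ))} (hinj : Function.Injective ι)
    (hιC : ∀ x y, ((LinearMap.BilinForm.pi fun _ : Fin 2 ↦ -e8Form).prod (hyperbolicSum 4)) (ι x) (ι y) =
      Matrix.toBilin' (k3HilbertGram n) x y)
    (hsat : ∀ (k : ℤ) z, k ≠ 0 → k • z ∈ LinearMap.range ι → z ∈ LinearMap.range ι)
    {h : K3HilbertIndex → ℤ} (hh : Matrix.toBilin' (k3HilbertGram n) h h ≠ 0) {t : ℤ} (ht : t ≠ 0)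
    (hdiv : ∀ y, t ∣ Matrix.toBilin' (k3HilbertGram n) h y) {y₀ : K3HilbertIndex → ℤ}
    (hy₀ : Matrix.toBilin' (k3HilbertGram n) h y₀ = t) :
    ((ℤ ∙ ι h) ⊔ ((LinearMap.BilinForm.pi fun _ : Fin 2 ↦ -e8Form).prod (hyperbolicSum 4)).orthogonal
          (LinearMap.range ι)).toAddSubgroup.relIndex
        (((LinearMap.BilinForm.pi fun _ : Fin 2 ↦ -e8Form).prod (hyperbolicSum 4)).orthogonal
          (((LinearMap.BilinForm.pi fun _ : Fin 2 ↦ -e8Form).prod (hyperbolicSum 4)).orthogonal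
            ((ℤ ∙ ι h) ⊔ ((LinearMap.BilinForm.pi fun _ : Fin 2 ↦ -e8Form).prod (hyperbolicSum 4)).orthogonal
              (LinearMap.range ι)))).toAddSubgroup = t.natAbs ∧
      ∃ (v z : (Fin 2 → Fin 8 → ℤ) × ((Fin 4 → ℤ) × (Fin 4 → ℤ))) (q : ℤ),
        ((LinearMap.BilinForm.pi fun _ : Fin 2 ↦ -e8Form).prod (hyperbolicSum 4)).orthogonal (LinearMap.range ι) =
            ℤ ∙ v ∧
          ((LinearMap.BilinForm.pi fun _ : Fin 2 ↦ -e8Form).prod (hyperbolicSum 4)) v v = 2 * (n - 1 : ℕ) ∧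
          t • z = ι h + q • v ∧
          ((LinearMap.BilinForm.pi fun _ : Fin 2 ↦ -e8Form).prod (hyperbolicSum 4)).orthogonal
              (((LinearMap.BilinForm.pi fun _ : Fin 2 ↦ -e8Form).prod (hyperbolicSum 4)).orthogonal
                ((ℤ ∙ ι h) ⊔ ((LinearMap.BilinForm.pi fun _ : Fin 2 ↦ -e8Form).prod (hyperbolicSum 4)).orthogonal
                  (LinearMap.range ι))) = (ℤ ∙ z) ⊔ (ℤ ∙ v) ∧
          t ^ 2 * (((LinearMap.BilinForm.pi fun _ : Fin 2 ↦ -e8Form).prod (hyperbolicSum 4)) z z * (2 * (n - 1 : ℕ)) -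
              ((LinearMap.BilinForm.pi fun _ : Fin 2 ↦ -e8Form).prod (hyperbolicSum 4)) z v ^ 2) =
            Matrix.toBilin' (k3HilbertGram n) h h * (2 * (n - 1 : ℕ)) := by
  obtain ⟨hs, -, hu⟩ := isSymm_isEven_isUnimodular_pi_neg_e8Form_prod_hyperbolicSum' 2 4
  haveI : ((LinearMap.BilinForm.pi fun _ : Fin 2 ↦ -e8Form).prod (hyperbolicSum 4)).IsPerfPair := hu
  obtain ⟨v, hprim, hrange, hSv, hvv⟩ := k3HilbertLattice_exists_range_eq_orthogonal_of_saturated hn hinj hιC hsat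
  have hv : ((LinearMap.BilinForm.pi fun _ : Fin 2 ↦ -e8Form).prod (hyperbolicSum 4)) v v ≠ 0 := by
    rw [hvv]; omega
  obtain ⟨z, q, hz, hT, hdisc⟩ :=
    exists_orthogonal_orthogonal_eq_span_sup _ hs hιC hv hrange hSv hprim hh ht hdiv hy₀
  refine ⟨relIndex_span_sup_orthogonal_eq _ hs hιC hv hrange hSv hprim hh ht hdiv hy₀, v, z, q, hSv, hvv, hz, hT, ?_⟩
  rw [← hvv]
  exact hdisc

end Literature.AlgebraicGeometry.Hyperkaehler

end
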